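import Mathlib.NumberTheory.Padics.ValuativeRel
import Mathlib.CategoryTheory.Discrete.Basic
import Mathlib.CategoryTheory.IsConnected
import Literature.AlgebraicGeometry.Frobenioids.PadicFrobenioid
import HarnessLib

/-!
# Frobenioids II, Example 1.1 (i) for `K = ℚ_p`: the `p`-adic Frobenioid of `ℚ_p`, hypothesis-free

Mochizuki, *The geometry of Frobenioids II*, Kyushu J. Math. **62** (2008) 401–460, §1 Example 1.1 (i),
author's text p. 7 [cite: MochizukiFrdII2008, Ex 1.1 (i) p.7]. This file INSTANTIATES the functorial
construction of `PadicFrobenioidZero.lean` / `PadicFrobenioid.lean` at the field `ℚ_p` itself (Mathlib's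
`Padic p` with its valuative relation): `Spec ℚ_p` is an object of the base `PadicFld p`
(`v(p) < 1`, Mathlib `Padic.valuation_p_lt_one`); the value monoid `ord(O_{ℚ_p}^⊳) = ℤ_{≥0}` is
`ℤ`-monoprime — PROVED (`ordIntPadicEquivNat`, via the `p`-adic valuation `Padic.valuation`); hence the
datum `Datum.zero` over the one-object base `Spec ℚ_p` has all its hypotheses discharged, and
`CZeroQp p` is the `p`-adic Frobenioid `C₀` of `ℚ_p` (over the trivial base) as an honest category.
No named facts.
-/

namespace Literature.AlgebraicGeometry.Frobenioids

open scoped ValuativeRel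
open CategoryTheory ValuativeRel Function WithZero

namespace PadicFrd

variable (p : ℕ) [Fact p.Prime]

/-! ### Integers and units of `ℚ_p` in terms of `Padic.valuation` -/

/-- Mathlib's bundled `p`-adic valuation on a nonzero element: `exp(-v_p(x))`.
[cite: MochizukiFrdII2008, Ex 1.1 (i) p.7] -/
theorem mulValuation_of_ne_zero {x : ℚ_[p]} (hx : x ≠ 0) : Padic.mulValuation x = exp (-x.valuation) := by
  simp [Padic.mulValuation, hx]

/-- For `x ≠ 0` in `ℚ_p`: `x ∈ O_{ℚ_p}` (valuation `≤ 1` in the valuative relation) iff the additive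
`p`-adic valuation of `x` is `≥ 0`. [cite: MochizukiFrdII2008, Ex 1.1 (i) p.7] -/
theorem padic_le_one_iff {x : ℚ_[p]} (hx : x ≠ 0) : valuation ℚ_[p] x ≤ 1 ↔ 0 ≤ x.valuation := by
  rw [← (valuation ℚ_[p]).vle_one_iff, (Padic.mulValuation (p := p)).vle_one_iff,
    mulValuation_of_ne_zero p hx, ← exp_zero, exp_le_exp, neg_nonpos]

/-- For `x ≠ 0` in `ℚ_p`: `x` is a unit of `O_{ℚ_p}` (valuation `= 1`) iff its additive `p`-adic
valuation is `0`. [cite: MochizukiFrdII2008, Ex 1.1 (i) p.7] -/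
theorem padic_eq_one_iff {x : ℚ_[p]} (hx : x ≠ 0) : valuation ℚ_[p] x = 1 ↔ x.valuation = 0 := by
  have h : valuation ℚ_[p] x = 1 ↔ Padic.mulValuation x = 1 := by
    rw [← map_one (valuation ℚ_[p]), ← (valuation ℚ_[p]).veq_iff_eq,
      (Padic.mulValuation (p := p)).veq_iff_eq, map_one]
  rw [h, mulValuation_of_ne_zero p hx, exp_eq_one, neg_eq_zero]

/-- Membership in `O_{ℚ_p}^⊳`: nonzero with nonnegative `p`-adic valuation.
[cite: MochizukiFrdII2008, Ex 1.1 (i) p.7] -/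
theorem mem_intNonzero_padic_iff {x : ℚ_[p]} : x ∈ intNonzero ℚ_[p] ↔ x ≠ 0 ∧ 0 ≤ x.valuation := by
  rw [mem_intNonzero_iff]
  constructor
  · rintro ⟨h1, h0⟩; exact ⟨h0, (padic_le_one_iff p h0).mp h1⟩
  · rintro ⟨h0, h1⟩; exact ⟨(padic_le_one_iff p h0).mpr h1, h0⟩

/-- `Spec ℚ_p` as an object of the base category `PadicFld p`: `p ∈ O_{ℚ_p}^⊳` and `v(p) < 1`.
[cite: MochizukiFrdII2008, Ex 1.1 (i) p.7] -/
noncomputable def qpFld : PadicFld.{0} p where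
  K := ℚ_[p]
  p_mem := ⟨(Padic.valuation_p_lt_one (valuation ℚ_[p])).le,
    Nat.cast_ne_zero.mpr (Fact.out : p.Prime).ne_zero⟩
  p_lt := Padic.valuation_p_lt_one (valuation ℚ_[p])

/-- **Example 1.1 (i)**, the objects of `D₀` in print (FrdII p. 7: "`Spec(K) ∈ Ob(D₀)` [i.e., `K` is a
finite extension of `ℚ_p`]"): a finite extension `K` of `ℚ_p` whose valuative relation extends the
`p`-adic one (Mathlib `ValuativeExtension ℚ_[p] K`) is an object of `PadicFld p` …
[cite: MochizukiFrdII2008, Ex 1.1 (i) p.7] -/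
noncomputable def ofFiniteExtension (K : Type) [Field K] [ValuativeRel K] [Algebra ℚ_[p] K]
    [ValuativeExtension ℚ_[p] K] : PadicFld.{0} p where
  K := K
  p_mem := by
    refine ⟨?_, ?_⟩
    · have h : ((p : ℕ) : ℚ_[p]) ≤ᵥ 1 :=
        (valuation ℚ_[p]).vle_one_iff.mpr (Padic.valuation_p_lt_one (valuation ℚ_[p])).le
      have h' : algebraMap ℚ_[p] K (p : ℚ_[p]) ≤ᵥ algebraMap ℚ_[p] K 1 :=
        (ValuativeExtension.vle_iff_vle _ _).mpr h
      rw [map_natCast, map_one] at h'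
      exact (valuation K).vle_one_iff.mp h'
    · rw [← map_natCast (algebraMap ℚ_[p] K) p]
      exact (map_ne_zero (algebraMap ℚ_[p] K)).mpr (Nat.cast_ne_zero.mpr (Fact.out : p.Prime).ne_zero)
  p_lt := by
    have h : ((p : ℕ) : ℚ_[p]) <ᵥ 1 :=
      (valuation ℚ_[p]).vlt_one_iff.mpr (Padic.valuation_p_lt_one (valuation ℚ_[p]))
    have h' : algebraMap ℚ_[p] K (p : ℚ_[p]) <ᵥ algebraMap ℚ_[p] K 1 := ValuativeExtension.vlt_iff_vlt.mpr h
    rw [map_natCast, map_one] at h'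
    exact (valuation K).vlt_one_iff.mp h'

/-- … and satisfies the standing hypothesis `IsPadicLocal` as soon as it is finite over `ℚ_p`.
[cite: MochizukiFrdII2008, Ex 1.1 (i) p.7] -/
theorem isPadicLocal_ofFiniteExtension (K : Type) [Field K] [ValuativeRel K] [Algebra ℚ_[p] K]
    [ValuativeExtension ℚ_[p] K] [hfin : Module.Finite ℚ_[p] K] : (ofFiniteExtension p K).IsPadicLocal := by
  refine ⟨⟨‹Algebra ℚ_[p] K›, ?_, ?_⟩⟩
  · exact hfin
  · exact fun a b => ValuativeExtension.vle_iff_vle (A := ℚ_[p]) (B := K) a b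

/-! ### `ord(O_{ℚ_p}^⊳) ≅ ℤ_{≥0}` -/

/-- The additive `p`-adic valuation on `O_{ℚ_p}^⊳`, valued in `ℕ` (written multiplicatively).
[cite: MochizukiFrdII2008, Ex 1.1 (i) p.7] -/
noncomputable def valNat : intNonzero ℚ_[p] →* Multiplicative ℕ where
  toFun x := Multiplicative.ofAdd ((x : ℚ_[p]).valuation.toNat)
  map_one' := by simp
  map_mul' x y := by
    have hx := (mem_intNonzero_padic_iff p).mp x.2
    have hy := (mem_intNonzero_padic_iff p).mp y.2
    rw [← ofAdd_add, Submonoid.coe_mul, Padic.valuation_mul hx.1 hy.1, Int.toNat_add hx.2 hy.2]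

/-- `valNat x` read back in `ℤ` is the `p`-adic valuation of `x`. [cite: MochizukiFrdII2008, Ex 1.1 (i) p.7] -/
theorem toAdd_valNat (x : intNonzero ℚ_[p]) :
    ((Multiplicative.toAdd (valNat p x) : ℕ) : ℤ) = (x : ℚ_[p]).valuation := by
  change (((x : ℚ_[p]).valuation.toNat : ℕ) : ℤ) = _
  exact Int.toNat_of_nonneg ((mem_intNonzero_padic_iff p).mp x.2).2

/-- Associated elements of `O_{ℚ_p}^⊳` have the same valuation (units have valuation `0`).
[cite: MochizukiFrdII2008, Ex 1.1 (i) p.7] -/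
theorem valNat_eq_of_associated {x y : intNonzero ℚ_[p]} (h : Associated x y) : valNat p x = valNat p y := by
  obtain ⟨u, rfl⟩ := h
  rw [map_mul]
  have hu : valNat p (u : intNonzero ℚ_[p]) = 1 := by
    have h1 := (isUnit_intNonzero_iff ℚ_[p] (u : intNonzero ℚ_[p])).mp u.isUnit
    have h0 : ((u : intNonzero ℚ_[p]) : ℚ_[p]) ≠ 0 := (u : intNonzero ℚ_[p]).2.2
    change Multiplicative.ofAdd (((u : intNonzero ℚ_[p]) : ℚ_[p]).valuation.toNat) = 1
    rw [(padic_eq_one_iff p h0).mp h1]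
    rfl
  rw [hu, mul_one]

/-- `ord(O_{ℚ_p}^⊳) → ℤ_{≥0}`, `[x] ↦ v_p(x)`. [cite: MochizukiFrdII2008, Ex 1.1 (i) p.7] -/
noncomputable def ordIntToNat : OrdInt ℚ_[p] →* Multiplicative ℕ where
  toFun := Quotient.lift (valNat p) fun _ _ h => valNat_eq_of_associated p h
  map_one' := by
    rw [Associates.one_eq_mk_one, ← Associates.quotient_mk_eq_mk, Quotient.lift_mk, map_one]
  map_mul' a b := by
    obtain ⟨a, rfl⟩ := Associates.mk_surjective a
    obtain ⟨b, rfl⟩ := Associates.mk_surjective b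
    rw [Associates.mk_mul_mk, ← Associates.quotient_mk_eq_mk, ← Associates.quotient_mk_eq_mk,
      ← Associates.quotient_mk_eq_mk, Quotient.lift_mk, Quotient.lift_mk, Quotient.lift_mk, map_mul]

/-- `ordIntToNat` on representatives. [cite: MochizukiFrdII2008, Ex 1.1 (i) p.7] -/
@[simp] theorem ordIntToNat_mk (x : intNonzero ℚ_[p]) : ordIntToNat p (Associates.mk x) = valNat p x := rfl

/-- `ord(O_{ℚ_p}^⊳) → ℤ_{≥0}` is injective: equal valuations means associated.
[cite: MochizukiFrdII2008, Ex 1.1 (i) p.7] -/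
theorem ordIntToNat_injective : Injective (ordIntToNat p) := by
  intro a b h
  obtain ⟨x, rfl⟩ := Associates.mk_surjective a
  obtain ⟨y, rfl⟩ := Associates.mk_surjective b
  rw [ordIntToNat_mk, ordIntToNat_mk] at h
  have hv : (x : ℚ_[p]).valuation = (y : ℚ_[p]).valuation := by
    rw [← toAdd_valNat, ← toAdd_valNat, h]
  -- reduce to the injectivity of `ord(O^⊳) ⊆ ord(K^×)`: the quotient `x⁻¹ y` is a unit
  apply ordIntToOrdUnits_injective ℚ_[p]
  rw [ordIntToOrdUnits_mk, ordIntToOrdUnits_mk, ordUnitsMk, QuotientGroup.mk'_apply,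
    QuotientGroup.mk'_apply, QuotientGroup.eq, mem_unitSubgroup_iff]
  have hx0 : (x : ℚ_[p]) ≠ 0 := x.2.2
  have hy0 : (y : ℚ_[p]) ≠ 0 := y.2.2
  have hq0 : ((x : ℚ_[p])⁻¹ * y) ≠ 0 := mul_ne_zero (inv_ne_zero hx0) hy0
  have e : (((intNonzeroToUnits ℚ_[p] x)⁻¹ * intNonzeroToUnits ℚ_[p] y : ℚ_[p]ˣ) : ℚ_[p]) =
      (x : ℚ_[p])⁻¹ * y := by
    rw [Units.val_mul, Units.val_inv_eq_inv_val, coe_intNonzeroToUnits, coe_intNonzeroToUnits]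
  rw [e, padic_eq_one_iff p hq0, Padic.valuation_mul (inv_ne_zero hx0) hy0, Padic.valuation_inv, hv,
    neg_add_cancel]

/-- `p ∈ O_{ℚ_p}^⊳`. [cite: MochizukiFrdII2008, Ex 1.1 (i) p.7] -/
theorem p_mem_intNonzero : ((p : ℕ) : ℚ_[p]) ∈ intNonzero ℚ_[p] := (qpFld p).p_mem

/-- `ord(O_{ℚ_p}^⊳) → ℤ_{≥0}` is surjective: `[pⁿ] ↦ n`. [cite: MochizukiFrdII2008, Ex 1.1 (i) p.7] -/
theorem ordIntToNat_surjective : Surjective (ordIntToNat p) := by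
  intro n
  refine ⟨Associates.mk (⟨(p : ℚ_[p]), p_mem_intNonzero p⟩ ^ (Multiplicative.toAdd n)), ?_⟩
  rw [ordIntToNat_mk, map_pow]
  have h1 : valNat p ⟨(p : ℚ_[p]), p_mem_intNonzero p⟩ = Multiplicative.ofAdd 1 := by
    change Multiplicative.ofAdd (((p : ℕ) : ℚ_[p]).valuation.toNat) = _
    rw [Padic.valuation_p]
    rfl
  rw [h1, ← ofAdd_nsmul, smul_eq_mul, mul_one]
  rfl

/-- `ord(O_{ℚ_p}^⊳) ≅ ℤ_{≥0}` ("`ord(V) (≅ ℤ)`", FrdII Ex. 1.1 (i), p. 8): the value monoid of `ℚ_p` is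
`ℤ`-monoprime — PROVED. [cite: MochizukiFrdII2008, Ex 1.1 (i) pp.7-8] -/
noncomputable def ordIntPadicEquivNat : OrdInt ℚ_[p] ≃* Multiplicative ℕ :=
  MulEquiv.ofBijective (ordIntToNat p) ⟨ordIntToNat_injective p, ordIntToNat_surjective p⟩

/-- `ord(O_{ℚ_p}^⊳)` is `ℤ`-monoprime. [cite: MochizukiFrdII2008, Ex 1.1 (i) pp.7-8] -/
theorem isZMonoprime_ordInt_padic : IsZMonoprime (OrdInt ℚ_[p]) := ⟨⟨ordIntPadicEquivNat p⟩⟩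

/-! ### The `p`-adic Frobenioid of `ℚ_p` over the trivial base -/

/-- The one-object base "`Spec ℚ_p`": the functor from the terminal category picking `ℚ_p`.
[cite: MochizukiFrdII2008, Ex 1.1 (i) p.7] -/
noncomputable def qpBase : Discrete PUnit.{1} ⥤ PadicFld.{0} p := (Functor.const _).obj (qpFld p)

/-- The one-object base is totally epimorphic (its only arrows are identities).
[cite: MochizukiFrdII2008, Ex 1.1 (i) p.7] -/
theorem isTotallyEpimorphic_discretePUnit : IsTotallyEpimorphic (Discrete PUnit.{1}) :=
  ⟨fun _ => ⟨fun g h _ => Subsingleton.elim g h⟩⟩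

/-- `Spec ℚ_p` is a `p`-adic local field in the sense of `PadicFld.IsPadicLocal` (trivially: `ℚ_p` is a
finite `ℚ_p`-algebra and the identity is valuative). [cite: MochizukiFrdII2008, Ex 1.1 (i) p.7] -/
theorem isPadicLocal_qpFld : (qpFld p).IsPadicLocal :=
  ⟨⟨Algebra.id ℚ_[p], Module.Finite.self ℚ_[p], fun _ _ => Iff.rfl⟩⟩

/-- **Example 1.1 (i)** for `ℚ_p` (FrdII p. 7): the datum of the `p`-adic Frobenioid `C₀` of `ℚ_p` over the
one-object base — ALL hypotheses discharged (`ord(O_{ℚ_p}^⊳)` monoprime by `isZMonoprime_ordInt_padic`).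
[cite: MochizukiFrdII2008, Ex 1.1 (i) p.7] -/
noncomputable def datumQp : Datum (Discrete PUnit.{1}) p :=
  Datum.zero (qpBase p) (fun _ => isPadicLocal_qpFld p) inferInstance (isTotallyEpimorphic_discretePUnit)
    fun _ => IsMonoprime.ofZ (isZMonoprime_ordInt_padic p)

/-- **Example 1.1 (i)** for `ℚ_p`: the `p`-adic Frobenioid `C₀` of `ℚ_p` (model Frobenioid of
`Φ₀ = ord(O_{ℚ_p}^⊳) ⊗ ℝ_{≥0}`, `B₀ = ℚ_p^×`), as an honest category.
[cite: MochizukiFrdII2008, Ex 1.1 (i) p.7] -/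
abbrev CZeroQp : Type := (datumQp p).frobenioid

/-- The structure functor `C₀(ℚ_p) → F_{Φ₀}`. [cite: MochizukiFrdII2008, Ex 1.1 (i) p.7] -/
noncomputable abbrev CZeroQp.structureFunctor : CZeroQp p ⥤ ElemFrobenioid (datumQp p).Φ :=
  (datumQp p).structureFunctor

end PadicFrd

end Literature.AlgebraicGeometry.Frobenioids
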